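import Summits.QuantumFields.BalabanUV.Beta.FP.AveragingJetLettersRootedSecond

/-!
# `Beta/FP/AveragingJetLettersRootedSecondStraight` — road «FP» (binder row D1), row **RHOA-6b′** companion (second jet): THE STRAIGHT INSTANCE of the
# generic rooted SECOND-JET kernel IS RHOA-6b's `q̈` (`FP/AveragingJetLettersSecond.qddot`) — the twin of `AveragingJetLettersRootedStraight.ker₁_straight_eq_qdot`
# (p245932) for the ordered nested pair: one-sided word, `n⁻⁵` weight, field letter at position `s`, OUTER insertion = the EARLIER position, Jacobi weight `1∣2`

HONEST FRAMING (cell `pub-balaban`, β sub-cell, verbatim): discharging `BetaPertH` makes Bałaban's UV stability UNCONDITIONAL — a real constructive-QFT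
result; it is NOT the continuum limit and NOT the Clay problem.  THIS MODULE is [folklore] finite bookkeeping: one counting identity between two of the
cell's OWN model kernels (`AveragingJetLettersRootedSecond.ker₂` at the rule-free block family and `AveragingJetLettersSecond.qddot`), no road object,
0 estimates, 0 cite, no `def`, no `def … : Prop`, 0 sorry.  «not in print; our bookkeeping».
HONEST DEPENDENCY: continuum YM on T⁴ ⇐ BetaPertH ∧ nine spine estimates (0/9 proved); BetaPertH ⇐ (D1) ∧ (D4) ∧ CAP+tail; G-an2-4 gates asym, D1 and NE2/3/4.

ABSOLUTE RULE (cell charter, verbatim): «No internally-minted statement may enter as a cited fact. Every hypothesis is either kernel-proved in this package or a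
verbatim quotation of a PUBLISHED theorem with page reference. The manuscript(s) under audit are NOT citable for their own disputed steps — they are the thing under
adjudication; programme-internal (2001/route/tribunal) claims are never citable.»

WHAT IS TYPED ([folklore], four theorems): `posInd_map_range` (the positional indicator of a `range`-indexed word tests the letter function),
`pairW_map_range` (the ordered nested pair weight of a `range`-indexed word as a double position sum `Σ_{j<s} Σ_{i≤j} w(i,j)·[f i = b″]·[f j = b′]`),
`ddotW_eq_sum` (gan24-leaf-04's weighted fibre count `ddotW` as the SAME double position sum, contour by contour, field condition folded in) and
**`ker₂_straight_eq_qddot`**: with ONE radial rule (`σ = Unit`, probability `1`), the EMPTY radial word and straight labels = base points, the block family's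
second-jet kernel of `AveragingJetLettersRootedSecond` §2 equals RHOA-6b's `qddot n μ y b″ b′ b = ddotW∕n⁵` ENTRYWISE — both weigh the quadruples
`((x′, s), j, i)`, `i ≤ j < s`, with the OUTER background letter at `n•y + x′ + i·e_μ = b″`, the INNER one at `n•y + x′ + j·e_μ = b′`, the field letter at
`n•y + x′ + s·e_μ = b`, weight `1` if `i = j` and `2` otherwise.  So every RHOA-6b second-jet letter of record (`AveragingJetLettersSecond`: `Σ_y q̈ ≤ 2∕n⁴`,
`Σ_yΣ_b q̈ ≤ 1∕n³` per ordered insertion pair, support, radius) is a letter of the rooted straight family by ONE `rw`, and a radial rule only PREPENDS letters.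
NOT the comb ∕ S_D instances, NOT power counting, NOT `Mix_n = O(1)`, NOT hbook, NOT D1, NOT BetaPertH.
Provenance: cross-lane idle-seat kernel duty G-an2-4 → β∕D1, unit `b2b-balaban-gan24-formalise-leaf-04` gen 42 (the `qddot`∕`nested_form` author lineage),
2026-08-21; companion of p246257 (XREAD C-gan24leaf04-g42-3, whose off-tree engine certified this identity for n ≤ 3 before it was typed); no existing file touched.
-/

noncomputable section

namespace Summit.QuantumFields.BalabanUV.Beta.FP.AveragingJetLettersRootedSecondStraight

open Finset
open scoped BigOperators
open Literature.MathematicalPhysics.QuantumFieldTheory.Balaban1983to89.Beta.DyadicShell (Pt)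
open Literature.MathematicalPhysics.QuantumFieldTheory.Balaban1983to89.Beta.AxialBlockWeights (idx pt)
open Summit.QuantumFields.BalabanUV.Beta.FP.AveragingJetLetters (mem_idx_iff dotIdx filter_lt_range)
open Summit.QuantumFields.BalabanUV.Beta.FP.AveragingJetLettersSecond (qddot ddotW ddotFiber ddotIdx ddotMap wt)
open Summit.QuantumFields.BalabanUV.Beta.FP.AveragingJetLettersRooted (blkW blkFld blkBg)
open Summit.QuantumFields.BalabanUV.Beta.FP.AveragingJetLettersRootedSecond (posInd pairW ker₂ posInd_eq_ite)

/-! ## §1 The ordered nested pair weight of a `range`-indexed word -/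

section Word

variable {B : Type*} [DecidableEq B]

/-- [folklore] the positional indicator of a `range`-indexed word tests the letter function: `posInd ((range s).map f) i b = [f i = b]` for `i < s`. -/
theorem posInd_map_range (f : ℕ → B) {s i : ℕ} (hi : i < s) (b : B) :
    posInd ((List.range s).map f) i b = if f i = b then 1 else 0 := by
  have hl : i < ((List.range s).map f).length := by simpa using hi
  rw [posInd_eq_ite _ hl]
  simp [List.getElem_map, List.getElem_range]

/-- [folklore] THE ORDERED NESTED PAIR WEIGHT OF A `range`-INDEXED WORD as a double position sum:
`pairW ((range s).map f) b″ b′ = Σ_{j<s} Σ_{i≤j} [f i = b″ ∧ f j = b′]·w(i,j)`, `w = 1∣2`. -/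
theorem pairW_map_range (f : ℕ → B) (s : ℕ) (b'' b' : B) :
    pairW ((List.range s).map f) b'' b' =
      ∑ j ∈ range s, ∑ i ∈ range (j + 1), if f i = b'' ∧ f j = b' then (if i = j then 1 else 2) else 0 := by
  unfold pairW
  rw [List.length_map, List.length_range]
  refine Finset.sum_congr rfl fun j hj => Finset.sum_congr rfl fun i hi => ?_
  have hj' : j < s := mem_range.mp hj
  have hi' : i < s := by have := mem_range.mp hi; omega
  rw [posInd_map_range f hi', posInd_map_range f hj']
  by_cases h1 : f i = b'' <;> by_cases h2 : f j = b' <;> simp [h1, h2]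

end Word

/-! ## §2 gan24-leaf-04's weighted fibre count as the same double position sum -/

/-- [folklore] **`ddotW` CONTOUR BY CONTOUR**: RHOA-6b's weighted integer kernel of the second jet (the `wt`-weighted cardinality of the fibre of `ddotMap` over
`(b″, b′, b)`) equals, summed over the contours `(x′, s)` of the block, the ordered nested pair weight of the straight word `[n•y + x′ + j·e_μ : j < s]` at
`(b″, b′)` when the field letter `n•y + x′ + s·e_μ` is `b`, and `0` otherwise. -/
theorem ddotW_eq_sum (n : ℕ) (μ : Fin 4) (y b'' b' b : Pt) :
    ddotW n μ y b'' b' b = ∑ q ∈ idx n,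
      if n • y + pt μ q = b then pairW ((List.range q.2).map fun j => n • y + pt μ (q.1, j)) b'' b' else 0 := by
  classical
  -- the common form: a triple position sum with the field condition folded into the indicator
  have hR : ∀ q ∈ idx n, (if n • y + pt μ q = b then pairW ((List.range q.2).map fun j => n • y + pt μ (q.1, j)) b'' b' else 0)
      = ∑ j ∈ range q.2, ∑ i ∈ range (j + 1),
          (if n • y + pt μ (q.1, i) = b'' ∧ n • y + pt μ (q.1, j) = b' ∧ n • y + pt μ q = b then (if i = j then 1 else 2) else 0) := by
    intro q _
    rw [pairW_map_range]
    split_ifs with hb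
    · refine Finset.sum_congr rfl fun j _ => Finset.sum_congr rfl fun i _ => ?_
      simp only [hb, and_true]
    · symm
      refine Finset.sum_eq_zero fun j _ => Finset.sum_eq_zero fun i _ => ?_
      simp only [hb, and_false, ite_false]
  rw [Finset.sum_congr rfl hR]
  -- gan24-leaf-04's side: unfold the fibre and the two filtered products down to the contours
  unfold ddotW ddotFiber
  rw [Finset.sum_filter, ddotIdx, Finset.sum_filter, Finset.sum_product, dotIdx, Finset.sum_filter, Finset.sum_product]
  refine Finset.sum_congr rfl fun q hq => ?_
  have hs : q.2 ≤ n := (mem_idx_iff.mp hq).2.le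
  rw [← filter_lt_range hs, Finset.sum_filter]
  refine Finset.sum_congr rfl fun j hj => ?_
  have hjn : j < n := mem_range.mp hj
  dsimp only
  split_ifs with hjs
  · have hj1 : j + 1 ≤ n := by omega
    rw [← filter_lt_range hj1, Finset.sum_filter]
    refine Finset.sum_congr rfl fun i _ => ?_
    simp only [ddotMap, wt, Prod.mk.injEq]
  · rfl

/-! ## §3 The straight instance of the rooted second-jet kernel IS RHOA-6b's `q̈` -/

/-- **THE STRAIGHT INSTANCE IS RHOA-6b's `q̈`**: one rule, probability `1`, NO radial word, straight labels = base points ⟹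
`ker₂ = AveragingJetLettersSecond.qddot n μ y` entrywise (same one-sided word, same `n⁻⁵`, same field position, OUTER letter = the EARLIER position,
Jacobi weight `1∣2`) — the second-jet twin of `AveragingJetLettersRootedStraight.ker₁_straight_eq_qdot`. [folklore] -/
theorem ker₂_straight_eq_qddot (n : ℕ) (μ : Fin 4) (y b'' b' b : Pt) :
    ker₂ (blkW n (fun _ : Unit => (1 : ℝ))) (blkFld n μ y) (blkBg n μ y (fun (_ : Unit) (_ _ : Pt) => ([] : List Pt)) id) b'' b' b
      = qddot n μ y b'' b' b := by
  classical
  unfold ker₂ blkW blkFld blkBg qddot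
  simp only [List.nil_append, id, mul_one]
  rw [Finset.sum_filter, Fintype.sum_prod_type]
  simp only [Finset.univ_unique, Finset.sum_singleton]
  rw [div_eq_inv_mul]
  -- pull the constant `n⁻⁵` out of the indicator sum
  have hite : ∀ q : ↥(idx n), (if n • y + pt μ q.1 = b then ((n : ℝ) ^ 5)⁻¹ *
      ((pairW ((List.range q.1.2).map fun j => n • y + pt μ (q.1.1, j)) b'' b' : ℕ) : ℝ) else 0)
      = ((n : ℝ) ^ 5)⁻¹ * (if n • y + pt μ q.1 = b then
          ((pairW ((List.range q.1.2).map fun j => n • y + pt μ (q.1.1, j)) b'' b' : ℕ) : ℝ) else 0) := by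
    intro q
    split_ifs with h
    · rfl
    · rw [mul_zero]
  simp_rw [hite]
  rw [← Finset.mul_sum]
  congr 1
  -- both sides weigh the quadruples `((x′, s), j, i)`, `i ≤ j < s`: outer `β` at `b″` (position `i`), inner `β` at `b′` (position `j`), `φ` at `b` (position `s`)
  rw [Finset.sum_coe_sort (idx n) (fun q => if n • y + pt μ q = b then
      ((pairW ((List.range q.2).map fun j => n • y + pt μ (q.1, j)) b'' b' : ℕ) : ℝ) else 0),
    ddotW_eq_sum]
  push_cast
  refine Finset.sum_congr rfl fun q _ => ?_
  split_ifs <;> simp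

end Summit.QuantumFields.BalabanUV.Beta.FP.AveragingJetLettersRootedSecondStraight

end
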